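import Summits.NavierStokesRegularity.NavierStokesRegularity.Theorems.TypeICertificateLadderTargetStrainCubeLambSplitDepletion
import Summits.NavierStokesRegularity.NavierStokesRegularity.Theorems.TypeICertificateLadderTargetOscillationRung
import Summits.NavierStokesRegularity.NavierStokesRegularity.Theorems.TypeICertificateLadderTargetNormalVelocityRung
import Summits.NavierStokesRegularity.NavierStokesRegularity.Theorems.TypeICertificateLadderTargetStretchingNumber
import Summits.NavierStokesRegularity.NavierStokesRegularity.Theorems.TypeICertificateLadderTargetRungOfDepletion
import Summits.NavierStokesRegularity.NavierStokesRegularity.Theorems.TypeICertificateLadderNoTypeIBlowupMorrey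
import Summits.NavierStokesRegularity.NavierStokesRegularity.Theorems.TypeICertificateLadderScaledEnergyBound
import Summits.NavierStokesRegularity.NavierStokesRegularity.Theorems.ScenarioCensusForward
import HarnessLib.Audit
import HarnessLib

/-!
# Blow-up scenario census — block F, row F1a (the explicit Type-I window)

Third file of block F of the cell `pub/ns-census` census (`SCENARIO-CENSUS.md` v1.6/v1.7, seat
ns-census-lead g2; keys fixed there).  Row F1a = forward · no symmetry · Clay class · Type I with an
EXPLICIT small dimensionless rate: eventually `√(T−t) ‖u(t,x)‖ ≤ C' √ν` with `(9+2√15)/42 · C' < 1`,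
i.e. `C' < 18 − 4√15 ≈ 2.508` (it contains the census's original "quiet window" `C² < 2ν`, i.e.
`C' < √2`).  EXCLUDED-IN-TREE by the closer of the certificate ladder
`STH.DepletionLadder.StrainCube.hasSmoothExtensionPast_of_rate_lt_lambSplit` (found for the census by
the refuter seat ns-census-ref g2, probe `P8.lean`; weaker rungs `…_of_rate_lt_sharp` (`C' < 18 − 9√3`),
`…_of_rate_lt`, Galilean `STH.DepletionLadder.hasSmoothExtensionPast_of_oscillationRate`).

Kept in its own small file on purpose: the closer's module imports the route file
`Theses.TypeICertificateLadder`, so this file carries the theses-cone warning (accepted knowingly; the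
main census files `ScenarioCensusForward(.Sub).lean` stay route-independent).  **Nothing here is a
claim about Navier–Stokes regularity beyond the cited tree theorem; no summit statement is proved by
this seat.**
-/

noncomputable section

-- the summit and its single problem share the name `NavierStokesRegularity` (D-0017 nested layout)
set_option linter.dupNamespace false

open Set Function Filter Topology MeasureTheory

namespace Summit.NavierStokesRegularity.NavierStokesRegularity.Theorems.ScenarioCensus

open Literature.Analysis Literature.Analysis.FluidPDE

/-- **Row F1a** (Type I with explicit small rate · no symmetry · Clay class): a classical Leray–Hopf
solution on `ℝ³ × [0,T)` from a rapidly decaying datum whose eventual dimensionless rate satisfies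
`√(T−t) ‖u(t,x)‖ ≤ C' √ν` for `t` near `T`, with `0 < C'` and `(9 + 2√15)/42 · C' < 1`
(`C' < 18 − 4√15 ≈ 2.508`), extends past `T`.  The statement of the tree theorem
`DepletionLadder.StrainCube.hasSmoothExtensionPast_of_rate_lt_lambSplit` (certificate ladder; Leray's
floor `c√ν (T−t)^{-1/2}` is the matching lower bound, so the loud regime `C' ≥ 2.508` is row F1).
EXCLUDED-IN-TREE. (ref: Leray1934 §19 (3.9) for the floor; tree ladder `DepletionLadder.*`) -/
def Row_F1a : Prop :=
  ∀ (ν T C : ℝ), 0 < ν → 0 < T → 0 < C → (9 + 2 * Real.sqrt 15) / 42 * C < 1 →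
    ∀ (u : ℝ → EuclideanSpace ℝ (Fin 3) → EuclideanSpace ℝ (Fin 3))
      (p : ℝ → EuclideanSpace ℝ (Fin 3) → ℝ),
    IsClassicalNSSolutionOn (Ico 0 T) ν 0 u p → IsLerayHopfOn T ν 0 (u 0) u →
    HasRapidSpatialDecay (u 0) →
    (∀ᶠ t in 𝓝[<] T, ∀ x, Real.sqrt (T - t) * ‖u t x‖ ≤ C * Real.sqrt ν) →
    HasSmoothExtensionPast ν 0 u T

/-- Row F1a is a theorem of the tree (`DepletionLadder.StrainCube.hasSmoothExtensionPast_of_rate_lt_lambSplit`).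
[folklore] -/
theorem row_F1a_excluded : Row_F1a := fun _ _ _ hν hT hC hκC _ _ hsol hLH hdec hrate =>
  DepletionLadder.StrainCube.hasSmoothExtensionPast_of_rate_lt_lambSplit hν hT hC hκC hsol hLH hdec hrate

/-- **Row F1a, quiet-window form** (the census's original normalisation, v1.0–v1.5): eventual rate
`√(T−t) ‖u(t,x)‖ ≤ C` with `0 < C`, `C² < 2ν` ⇒ extension past `T`.  Contained in `Row_F1a`
(`C' = C/√ν < √2 < 18 − 4√15`); the arithmetic is the census refuter's probe `P8.lean`
(`CensusProbeP8.f1a_census`).  EXCLUDED-IN-TREE (`row_F1aQuiet_excluded`). (folklore) -/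
def Row_F1aQuiet : Prop :=
  ∀ (ν T C : ℝ), 0 < ν → 0 < T → 0 < C → C ^ 2 < 2 * ν →
    ∀ (u : ℝ → EuclideanSpace ℝ (Fin 3) → EuclideanSpace ℝ (Fin 3))
      (p : ℝ → EuclideanSpace ℝ (Fin 3) → ℝ),
    IsClassicalNSSolutionOn (Ico 0 T) ν 0 u p → IsLerayHopfOn T ν 0 (u 0) u →
    HasRapidSpatialDecay (u 0) →
    (∀ᶠ t in 𝓝[<] T, ∀ x, Real.sqrt (T - t) * ‖u t x‖ ≤ C) →
    HasSmoothExtensionPast ν 0 u T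

/-- The quiet window is inside row F1a (arithmetic of the refuter's probe `P8.lean`). [folklore] -/
theorem row_F1aQuiet_excluded : Row_F1aQuiet := by
  intro ν T C hν hT hC hC2 u p hsol hLH hdec hrate
  have hsν : 0 < Real.sqrt ν := Real.sqrt_pos.mpr hν
  have hC'pos : 0 < C / Real.sqrt ν := div_pos hC hsν
  have hC'sq : (C / Real.sqrt ν) ^ 2 < 2 := by
    rw [div_pow, Real.sq_sqrt hν.le, div_lt_iff₀ hν]; linarith
  have hC'lt : C / Real.sqrt ν < 3 / 2 := by nlinarith [hC'pos, hC'sq]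
  have h15 : Real.sqrt 15 < 4 := by
    rw [show (4 : ℝ) = Real.sqrt (4 ^ 2) by rw [Real.sqrt_sq (by norm_num)]]
    exact Real.sqrt_lt_sqrt (by norm_num) (by norm_num)
  have hκ : (9 + 2 * Real.sqrt 15) / 42 * (C / Real.sqrt ν) < 1 := by
    have h1 : 0 < 9 + 2 * Real.sqrt 15 := by positivity
    have h2 := mul_lt_mul_of_pos_left hC'lt h1
    have h3 : (9 + 2 * Real.sqrt 15) * (3 / 2 : ℝ) < 17 * (3 / 2) := by nlinarith
    nlinarith
  have hrate' : ∀ᶠ t in 𝓝[<] T, ∀ x,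
      Real.sqrt (T - t) * ‖u t x‖ ≤ C / Real.sqrt ν * Real.sqrt ν := by
    refine hrate.mono fun t ht x => ?_
    rw [div_mul_cancel₀ C hsν.ne']
    exact ht x
  exact row_F1a_excluded ν T (C / Real.sqrt ν) hν hT hC'pos hκ u p hsol hLH hdec hrate'

/-! ## Row F1f: the Type-I certificate ladder — four representative rungs, verbatim
(appended 2026-08-28; census v1.6–v1.8 row F1f lists 31 rungs `STH.DepletionLadder.*`,
`STH.FiveHalvesWindow.*`, `STH.hasSmoothExtensionPast_of_powerRate`, all kernel-closed with standard
axioms by the refuter seat (probe `P7.lean`, r00–r30); each = «census frame + ONE depletion / rate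
condition ⇒ `HasSmoothExtensionPast`».  Typed here: the Galilean oscillation rung (r00), the
normal-velocity rung (r08), the stretching-number criterion (r11) and the subcritical-`H¹`-growth
rung (r04); the other 27 are cited by name in `SCENARIO-CENSUS.md` row F1f / AUDIT.md §3.) -/

open scoped RealInnerProductSpace

/-- **Row F1f (oscillation rung, r00)** — Galilean form of F1a: census frame (classical on
`ℝ³ × [0,T)`, `ν, T > 0`, Leray–Hopf from a rapidly decaying datum) and, for `t` near `T`, constant
vectors `c_t` with `√(T−t) ‖u(t,x) − c_t‖ ≤ C√ν` for all `x`, `0 < C`, `(2+√3)/9 · C < 1`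
(`C < 18 − 9√3 ≈ 2.4115`) ⇒ extension past `T`.  The statement of
`DepletionLadder.hasSmoothExtensionPast_of_oscillationRate`.  EXCLUDED-IN-TREE. (ref: tree ladder
`DepletionLadder`, route TypeICertificateLadder) -/
def Row_F1fOsc : Prop :=
  ∀ (ν T C : ℝ), 0 < ν → 0 < T → 0 < C → (2 + Real.sqrt 3) / 9 * C < 1 →
    ∀ (u : ℝ → EuclideanSpace ℝ (Fin 3) → EuclideanSpace ℝ (Fin 3))
      (p : ℝ → EuclideanSpace ℝ (Fin 3) → ℝ),
    IsClassicalNSSolutionOn (Ico 0 T) ν 0 u p → IsLerayHopfOn T ν 0 (u 0) u →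
    HasRapidSpatialDecay (u 0) →
    (∀ᶠ t in 𝓝[<] T, ∃ c : EuclideanSpace ℝ (Fin 3), ∀ x,
      Real.sqrt (T - t) * ‖u t x - c‖ ≤ C * Real.sqrt ν) →
    HasSmoothExtensionPast ν 0 u T

/-- Row F1f (oscillation rung) is a theorem of the tree. [folklore] -/
theorem row_F1fOsc_excluded : Row_F1fOsc := fun _ _ _ hν hT hC hκC _ _ hsol hLH hdec hrate =>
  DepletionLadder.hasSmoothExtensionPast_of_oscillationRate hν hT hC hκC hsol hLH hdec hrate

/-- **Row F1f (normal-velocity rung, r08)**: census frame and, eventually as `t ↑ T`,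
`√(T−t) ‖u(t,x) × ω(t,x)‖ ≤ C_⊥ √ν ‖ω(t,x)‖` for all `x` (`ω = curl u`), with `0 ≤ C_⊥ < 1` — a
Type-I rate on the component of the velocity NORMAL to the vorticity only — ⇒ extension past `T`,
whatever the full speed does.  The statement of
`DepletionLadder.hasSmoothExtensionPast_of_normalVelocityRate`.  EXCLUDED-IN-TREE. (ref: tree ladder
`DepletionLadder`) -/
def Row_F1fNormal : Prop :=
  ∀ (ν T Cn : ℝ), 0 < ν → 0 < T → 0 ≤ Cn → Cn < 1 →
    ∀ (u : ℝ → EuclideanSpace ℝ (Fin 3) → EuclideanSpace ℝ (Fin 3))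
      (p : ℝ → EuclideanSpace ℝ (Fin 3) → ℝ),
    IsClassicalNSSolutionOn (Ico 0 T) ν 0 u p → IsLerayHopfOn T ν 0 (u 0) u →
    HasRapidSpatialDecay (u 0) →
    (∀ᶠ t in 𝓝[<] T, ∀ x,
      Real.sqrt (T - t) * ‖cross (u t x) (curl (u t) x)‖ ≤ Cn * Real.sqrt ν * ‖curl (u t) x‖) →
    HasSmoothExtensionPast ν 0 u T

/-- Row F1f (normal-velocity rung) is a theorem of the tree. [folklore] -/
theorem row_F1fNormal_excluded : Row_F1fNormal :=
  fun _ _ _ hν hT hCn0 hCn _ _ hsol hLH hdec hrate =>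
    DepletionLadder.hasSmoothExtensionPast_of_normalVelocityRate hν hT hCn0 hCn hsol hLH hdec hrate

/-- **Row F1f (stretching-number criterion, r11)**: census frame and, eventually as `t ↑ T`, the
enstrophy production obeys `∫⟪ω, ∇u ω⟫(t) ≤ γ √(ν/(T−t)) ‖ω(t)‖₂ ‖∇ω(t)‖₂` with `0 ≤ γ < 1` ⇒
extension past `T` (Type I with constant `C` gives `γ = C` by Cauchy–Schwarz; geometric depletion
lowers `γ`).  The statement of `DepletionLadder.hasSmoothExtensionPast_of_stretching_le`.
EXCLUDED-IN-TREE. (ref: tree ladder `DepletionLadder`) -/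
def Row_F1fStretch : Prop :=
  ∀ (ν T γ : ℝ), 0 < ν → 0 < T → 0 ≤ γ → γ < 1 →
    ∀ (u : ℝ → EuclideanSpace ℝ (Fin 3) → EuclideanSpace ℝ (Fin 3))
      (p : ℝ → EuclideanSpace ℝ (Fin 3) → ℝ),
    IsClassicalNSSolutionOn (Ico 0 T) ν 0 u p → IsLerayHopfOn T ν 0 (u 0) u →
    HasRapidSpatialDecay (u 0) →
    (∀ᶠ t in 𝓝[<] T, ∫ x, ⟪curl (u t) x, fderiv ℝ (u t) x (curl (u t) x)⟫ ≤
      γ * Real.sqrt (ν / (T - t)) * Real.sqrt (∫ x, ‖curl (u t) x‖ ^ 2) *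
        Real.sqrt (∫ x, frobeniusNormSq (fderiv ℝ (curl (u t)) x))) →
    HasSmoothExtensionPast ν 0 u T

/-- Row F1f (stretching-number criterion) is a theorem of the tree. [folklore] -/
theorem row_F1fStretch_excluded : Row_F1fStretch :=
  fun _ _ _ hν hT hγ hγ1 _ _ hsol hLH hdec hS =>
    DepletionLadder.hasSmoothExtensionPast_of_stretching_le hν hT hγ hγ1 hsol hLH hdec hS

/-- **Row F1f (subcritical `H¹`-growth rung, r04)**: census frame and, on some `[t₀, T)`,
`‖u(t)‖₂² + ‖∇u(t)‖₂² ≤ K (T−t)^{−γ}` with `γ < 1/2` ⇒ extension past `T` (Leray's `H¹` blow-up rate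
`‖∇u(t)‖₂ ≳ ν^{3/4}(T−t)^{−1/4}` is the matching floor).  The statement of
`hasSmoothExtensionPast_of_powerRate`.  EXCLUDED-IN-TREE. (ref: Leray1934, §19 (3.9); tree ladder) -/
def Row_F1fPower : Prop :=
  ∀ (ν T γ K : ℝ), 0 < ν → 0 < T → γ < 1 / 2 →
    ∀ (u : ℝ → EuclideanSpace ℝ (Fin 3) → EuclideanSpace ℝ (Fin 3))
      (p : ℝ → EuclideanSpace ℝ (Fin 3) → ℝ),
    IsClassicalNSSolutionOn (Ico 0 T) ν 0 u p → IsLerayHopfOn T ν 0 (u 0) u →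
    HasRapidSpatialDecay (u 0) →
    (∃ t₀ ∈ Ico 0 T, ∀ t ∈ Ico t₀ T,
      (∫⁻ x, ‖u t x‖ₑ ^ 2) + ∫⁻ x, ENNReal.ofReal (frobeniusNormSq (fderiv ℝ (u t) x)) ≤
        ENNReal.ofReal (K * (T - t) ^ (-γ))) →
    HasSmoothExtensionPast ν 0 u T

/-- Row F1f (subcritical `H¹`-growth rung) is a theorem of the tree. [folklore] -/
theorem row_F1fPower_excluded : Row_F1fPower :=
  fun _ _ _ _ hν hT hγ _ _ hsol hLH hdec hK =>
    Theorems.hasSmoothExtensionPast_of_powerRate hν hT hγ hsol hLH hdec hK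

/-! ## Row F1 ⇐ Row F1e (appended 2026-08-28): no LOCAL Type-I singular point ⇒ no Type-I blow-up
of a Clay / Leray–Hopf solution — UNCONDITIONAL in tree (the Morrey input `ScaledEnergyBound`,
item ⟨2884⟩ of this file's route cone, is PROVED: `typeICertificateLadder_scaledEnergyBound_proof`). -/

/-- **F1e ⇒ F1.** If no local Type-I singular point exists (`Row_F1e = ¬ LocalTypeISingularityExists`,
Albritton–Barker 2019 Thm 1.1, first bullet; = block-A row A2 by `row_F1e_iff_row_A2`), then no
classical Leray–Hopf solution from a rapidly decaying datum blows up at the Type-I rate (`Row_F1` =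
⟨1217⟩ `NoTypeIBlowup` verbatim): the Type-I rate gives the uniform Morrey bound near `T`
(`ScaledEnergyBound`, PROVED in tree), hence boundedness on a backward cylinder at every `(T, x₀)`
(`isBackwardBoundedAt_of_morrey_of_not_localTypeISingularityExists`), hence continuation
(Lemarié-Rieusset 2016 Thm 15.1 (C)) — the tree theorem
`noTypeIBlowup_of_scaledEnergyBound_of_not_localTypeISingularityExists` with its first input
discharged.  So the census chain reads F1 ⇐ F1e ⇔ A2 ⇐ A1 = (L), all links in tree.
[cite: AlbrittonBarker2019, Thm. 1.1; LemarieRieusset2016, Thm 15.1 (C)] -/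
theorem row_F1_of_row_F1e (h : Row_F1e) : Row_F1 :=
  Theorems.noTypeIBlowup_of_scaledEnergyBound_of_not_localTypeISingularityExists
    Theorems.typeICertificateLadder_scaledEnergyBound_proof h

/-- Hence F1e also gives F0's Type-I half together with F4: `Row_F1e → Row_F4 → Row_F0`. [folklore] -/
theorem row_F0_of_row_F1e_of_row_F4 (h₁ : Row_F1e) (h₄ : Row_F4) : Row_F0 :=
  row_F0_of_F1_F4 (row_F1_of_row_F1e h₁) h₄

end Summit.NavierStokesRegularity.NavierStokesRegularity.Theorems.ScenarioCensus

end
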